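import Summits.Ventures.HodgeRepro2.PeterssonCompact

/-!
# The polarised Petersson density on the ball and its descent to `Γ\𝔹²`

Kernel support for the blind cell pub-hodge-repro2 (seat p2), T5-ID §ID-4(b′) (the Hodge / `L²` inner
product of two forms on the compact quotient `S = Γ\𝔹²`).  Row 86 (`PeterssonNorm.lean`) built the
Petersson density `|f(z)|² (1 − ‖z‖²)^k` of one weight-`k` form and row 88 (`PeterssonCompact.lean`) its
descent to `Γ\𝔹²`.  This file polarises it: for two functions `f, g` of weight `k` for the same `S`,

  `⟨f, g⟩_k(z) := f(z) · \overline{g(z)} · (1 − ‖z‖²)^k`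

is `S`-invariant, sesquilinear (linear in `f`, conjugate-linear in `g`), hermitian
(`⟨g, f⟩ = \overline{⟨f, g⟩}`), and `⟨f, f⟩_k = |f|² (1 − ‖z‖²)^k` is the density of row 86; it descends
to a continuous function on `Γ\𝔹²`.  Its integral against a measure on `Γ\𝔹²` — the Petersson inner
product — is treated in `PeterssonInner.lean`.
-/

namespace Summit.Ventures.HodgeRepro2.ShimuraData

open Complex

/-- The polarised Petersson density `⟨f, g⟩_k(z) := f(z) · \overline{g(z)} · (1 − ‖z‖²)^k`. -/
noncomputable def peterssonPair (k : ℕ) (f g : (Fin 2 → ℂ) → ℂ) (z : Fin 2 → ℂ) : ℂ :=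
  f z * (starRingEnd ℂ) (g z) * (((1 - normSq₂ z) ^ k : ℝ) : ℂ)

/-- The polarised density of a form with itself is the Petersson density of row 86. -/
theorem peterssonPair_self (k : ℕ) (f : (Fin 2 → ℂ) → ℂ) (z : Fin 2 → ℂ) :
    peterssonPair k f f z = ((petersson k f z : ℝ) : ℂ) := by
  unfold peterssonPair petersson
  rw [Complex.mul_conj, Complex.normSq_eq_norm_sq]
  push_cast
  ring

/-- Hermitian symmetry: `⟨g, f⟩_k = \overline{⟨f, g⟩_k}`. -/
theorem peterssonPair_swap (k : ℕ) (f g : (Fin 2 → ℂ) → ℂ) (z : Fin 2 → ℂ) :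
    peterssonPair k g f z = (starRingEnd ℂ) (peterssonPair k f g z) := by
  unfold peterssonPair
  simp only [map_mul, Complex.conj_conj, Complex.conj_ofReal]
  ring

/-- Additivity in the first variable. -/
theorem peterssonPair_add_left (k : ℕ) (f₁ f₂ g : (Fin 2 → ℂ) → ℂ) (z : Fin 2 → ℂ) :
    peterssonPair k (f₁ + f₂) g z = peterssonPair k f₁ g z + peterssonPair k f₂ g z := by
  unfold peterssonPair
  simp only [Pi.add_apply]
  ring

/-- Homogeneity in the first variable. -/
theorem peterssonPair_smul_left (k : ℕ) (c : ℂ) (f g : (Fin 2 → ℂ) → ℂ) (z : Fin 2 → ℂ) :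
    peterssonPair k (c • f) g z = c * peterssonPair k f g z := by
  unfold peterssonPair
  simp only [Pi.smul_apply, smul_eq_mul]
  ring

/-- Additivity in the second variable. -/
theorem peterssonPair_add_right (k : ℕ) (f g₁ g₂ : (Fin 2 → ℂ) → ℂ) (z : Fin 2 → ℂ) :
    peterssonPair k f (g₁ + g₂) z = peterssonPair k f g₁ z + peterssonPair k f g₂ z := by
  unfold peterssonPair
  simp only [Pi.add_apply, map_add]
  ring

/-- Conjugate-homogeneity in the second variable. -/
theorem peterssonPair_smul_right (k : ℕ) (c : ℂ) (f g : (Fin 2 → ℂ) → ℂ) (z : Fin 2 → ℂ) :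
    peterssonPair k f (c • g) z = (starRingEnd ℂ) c * peterssonPair k f g z := by
  unfold peterssonPair
  simp only [Pi.smul_apply, smul_eq_mul, map_mul]
  ring

/-- The zero form pairs to zero. -/
theorem peterssonPair_zero_left (k : ℕ) (g : (Fin 2 → ℂ) → ℂ) (z : Fin 2 → ℂ) :
    peterssonPair k 0 g z = 0 := by
  simp [peterssonPair]

/-- `⟨f, g⟩_k` is `U(2,1)`-invariant for two functions transforming with weight `k` under `γ`:
`f(γz) \overline{g(γz)} (1 − ‖γz‖²)^k = f(z) \overline{g(z)} (1 − ‖z‖²)^k`. -/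
theorem peterssonPair_ballAction {k : ℕ} {f g : (Fin 2 → ℂ) → ℂ} {γ : Matrix (Fin 3) (Fin 3) ℂ}
    (hγU : IsInU21 γ) {z : Fin 2 → ℂ} (hz : z ∈ ball₂)
    (hf : f (ballAction γ z) = autFactor γ z ^ k * f z)
    (hg : g (ballAction γ z) = autFactor γ z ^ k * g z) :
    peterssonPair k f g (ballAction γ z) = peterssonPair k f g z := by
  have hD : autFactor γ z ≠ 0 := IsInU21.autFactor_ne_zero hγU hz
  unfold peterssonPair
  rw [hf, hg, one_sub_normSq₂_ballAction hγU hz, map_mul, map_pow]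
  have hjj : autFactor γ z * (starRingEnd ℂ) (autFactor γ z) = ((‖autFactor γ z‖ : ℝ) : ℂ) ^ 2 := by
    rw [Complex.mul_conj, Complex.normSq_eq_norm_sq]
    push_cast
    ring
  calc autFactor γ z ^ k * f z * ((starRingEnd ℂ) (autFactor γ z) ^ k * (starRingEnd ℂ) (g z)) *
        ((((1 - normSq₂ z) / ‖autFactor γ z‖ ^ 2) ^ k : ℝ) : ℂ)
      = (autFactor γ z * (starRingEnd ℂ) (autFactor γ z)) ^ k * (f z * (starRingEnd ℂ) (g z)) *
          ((((1 - normSq₂ z) / ‖autFactor γ z‖ ^ 2) ^ k : ℝ) : ℂ) := by ring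
    _ = f z * (starRingEnd ℂ) (g z) * (((1 - normSq₂ z) ^ k : ℝ) : ℂ) := by
      have h1 : ((1 - normSq₂ z) / ‖autFactor γ z‖ ^ 2) ^ k * (‖autFactor γ z‖ ^ 2) ^ k
          = (1 - normSq₂ z) ^ k := by
        rw [div_pow, div_mul_cancel₀ _ (pow_ne_zero _ (pow_ne_zero _ (norm_ne_zero_iff.mpr hD)))]
      rw [hjj, ← h1]
      push_cast
      ring

/-- `S`-invariance of the polarised density of two weight-`k` forms for `S` (the `frameAction` of
row 74), the hypothesis of `ballQuotientLift`. -/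
theorem peterssonPair_frameAction_smul {K : Type*} [Field K] [NumberField K] [NumberField.IsCMField K]
    {τ₁ : K →+* ℂ} {H : Matrix (Fin 3) (Fin 3) K} {Q : Matrix (Fin 3) (Fin 3) ℂ}
    (hQ : IsFrame K τ₁ H Q) (S : Subgroup (GL (Fin 3) K)) (hS : (S : Set (GL (Fin 3) K)) ⊆ unitaryGroup K H)
    {k : ℕ} {f g : (Fin 2 → ℂ) → ℂ} (hf : IsWeightFor τ₁ Q S k f) (hg : IsWeightFor τ₁ Q S k g)
    (γ : S) (z : ball₂) :
    letI := frameAction hQ S hS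
    peterssonPair k f g ((γ • z : ball₂) : Fin 2 → ℂ) = peterssonPair k f g (z : Fin 2 → ℂ) := by
  letI := frameAction hQ S hS
  rw [frameAction_smul_coe hQ S hS γ z]
  exact peterssonPair_ballAction (IsFrame.isInU21_realEmbedding hQ (hS γ.property)) z.property
    (hf γ γ.property z z.property) (hg γ γ.property z z.property)

section WeightClosure

variable {K : Type*} [Field K] {τ₁ : K →+* ℂ} {Q : Matrix (Fin 3) (Fin 3) ℂ} {S : Subgroup (GL (Fin 3) K)}
  {k : ℕ}

/-- The zero function has every weight. -/
theorem isWeightFor_zero : IsWeightFor τ₁ Q S k (0 : (Fin 2 → ℂ) → ℂ) := fun _ _ _ _ => by simp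

/-- Weight-`k` functions for `S` are closed under addition. -/
theorem IsWeightFor.add {f g : (Fin 2 → ℂ) → ℂ} (hf : IsWeightFor τ₁ Q S k f)
    (hg : IsWeightFor τ₁ Q S k g) : IsWeightFor τ₁ Q S k (f + g) := fun γ hγ z hz => by
  simp only [Pi.add_apply, hf γ hγ z hz, hg γ hγ z hz]
  ring

/-- Weight-`k` functions for `S` are closed under scalar multiplication. -/
theorem IsWeightFor.smul (c : ℂ) {f : (Fin 2 → ℂ) → ℂ} (hf : IsWeightFor τ₁ Q S k f) :
    IsWeightFor τ₁ Q S k (c • f) := fun γ hγ z hz => by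
  simp only [Pi.smul_apply, smul_eq_mul, hf γ hγ z hz]
  ring

/-- Weight-`k` functions for `S` are closed under negation. -/
theorem IsWeightFor.neg {f : (Fin 2 → ℂ) → ℂ} (hf : IsWeightFor τ₁ Q S k f) :
    IsWeightFor τ₁ Q S k (-f) := fun γ hγ z hz => by
  simp only [Pi.neg_apply, hf γ hγ z hz]
  ring

end WeightClosure

section Quotient

variable {K : Type*} [Field K] [NumberField K] [NumberField.IsCMField K]
    {τ₁ : K →+* ℂ} {H : Matrix (Fin 3) (Fin 3) K} {Q : Matrix (Fin 3) (Fin 3) ℂ}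
    (hQ : IsFrame K τ₁ H Q) (S : Subgroup (GL (Fin 3) K)) (hS : (S : Set (GL (Fin 3) K)) ⊆ unitaryGroup K H)

/-- The polarised Petersson density of two weight-`k` forms for `S`, descended to `Γ\𝔹²`. -/
noncomputable def peterssonPairQuotient {k : ℕ} {f g : (Fin 2 → ℂ) → ℂ}
    (hf : IsWeightFor τ₁ Q S k f) (hg : IsWeightFor τ₁ Q S k g) : ballQuotient hQ S hS → ℂ :=
  ballQuotientLift hQ S hS (fun z : ball₂ => peterssonPair k f g (z : Fin 2 → ℂ))
    (peterssonPair_frameAction_smul hQ S hS hf hg)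

/-- The descended density evaluated at the class of `z` is `⟨f, g⟩_k(z)`. -/
theorem peterssonPairQuotient_mk {k : ℕ} {f g : (Fin 2 → ℂ) → ℂ}
    (hf : IsWeightFor τ₁ Q S k f) (hg : IsWeightFor τ₁ Q S k g) (z : ball₂) :
    peterssonPairQuotient hQ S hS hf hg (ballQuotient.mk hQ S hS z) =
      peterssonPair k f g (z : Fin 2 → ℂ) :=
  ballQuotientLift_mk hQ S hS _ _ z

/-- The polarised density is continuous on the ball when `f` and `g` are. -/
theorem continuousOn_peterssonPair (k : ℕ) {f g : (Fin 2 → ℂ) → ℂ} (hfc : ContinuousOn f ball₂)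
    (hgc : ContinuousOn g ball₂) : ContinuousOn (peterssonPair k f g) ball₂ := by
  unfold peterssonPair
  refine ((hfc.mul (Complex.continuous_conj.comp_continuousOn hgc)).mul ?_)
  exact Complex.continuous_ofReal.comp_continuousOn
    (((continuous_const.sub continuous_normSq₂).pow k).continuousOn)

/-- The descended polarised density is continuous on `Γ\𝔹²`. -/
theorem continuous_peterssonPairQuotient {k : ℕ} {f g : (Fin 2 → ℂ) → ℂ}
    (hf : IsWeightFor τ₁ Q S k f) (hg : IsWeightFor τ₁ Q S k g) (hfc : ContinuousOn f ball₂)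
    (hgc : ContinuousOn g ball₂) : Continuous (peterssonPairQuotient hQ S hS hf hg) := by
  rw [continuous_ballQuotient_iff]
  have : (peterssonPairQuotient hQ S hS hf hg ∘ ballQuotient.mk hQ S hS) =
      fun z : ball₂ => peterssonPair k f g (z : Fin 2 → ℂ) := by
    funext z
    exact peterssonPairQuotient_mk hQ S hS hf hg z
  rw [this]
  exact (continuousOn_peterssonPair k hfc hgc).comp_continuous continuous_subtype_val
    (fun z => z.property)

/-- The descended polarised density of `f` with itself is the descended Petersson density of row 88. -/
theorem peterssonPairQuotient_self {k : ℕ} {f : (Fin 2 → ℂ) → ℂ} (hf : IsWeightFor τ₁ Q S k f)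
    (x : ballQuotient hQ S hS) :
    peterssonPairQuotient hQ S hS hf hf x = ((peterssonQuotient hQ S hS hf x : ℝ) : ℂ) := by
  obtain ⟨z, rfl⟩ := ballQuotient_mk_surjective hQ S hS x
  rw [peterssonPairQuotient_mk, peterssonQuotient_mk, peterssonPair_self]

/-- Hermitian symmetry of the descended density. -/
theorem peterssonPairQuotient_swap {k : ℕ} {f g : (Fin 2 → ℂ) → ℂ}
    (hf : IsWeightFor τ₁ Q S k f) (hg : IsWeightFor τ₁ Q S k g) (x : ballQuotient hQ S hS) :
    peterssonPairQuotient hQ S hS hg hf x = (starRingEnd ℂ) (peterssonPairQuotient hQ S hS hf hg x) := by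
  obtain ⟨z, rfl⟩ := ballQuotient_mk_surjective hQ S hS x
  rw [peterssonPairQuotient_mk, peterssonPairQuotient_mk, peterssonPair_swap]

end Quotient

end Summit.Ventures.HodgeRepro2.ShimuraData
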